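import Summits.HubbardSuperconductivity.HubbardSuperconductivity.Theses.SpNLargeN
import Summits.HubbardSuperconductivity.HubbardSuperconductivity.Theorems.TwTipContinuation.Negative.TipNormalForm

/-!
# Route `SpNLargeN` — the glue items

Three bookkeeping items of route `SpNLargeN` (sub-problem `HubbardSuperconductivity`):

* `EvenTorusBookkeeping` (stmt-HubbardSuperconductivity-1668): the shifted even-side `liminf`
  `0 < liminf_k Re⟨ψ_{2(k+1)}, Δ_d†Δ_d ψ_{2(k+1)}⟩ / (2(k+1))⁴` is the summit's `HasLongRangeOrder`
  conclusion — the shift `k ↦ k + 1` does not change a `liminf` along `atTop`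
  (`Filter.liminf_nat_add`), and at a nonzero even side the LRO-sequence term is
  `Re⟨ψ_{2k}, Δ_d†Δ_d ψ_{2k}⟩ / (2k)⁴` (`lroTerm_eq`).
* `SpnTargetOfCruxes` (stmt-HubbardSuperconductivity-14259): `TUJSmallJ → SuperexchangeDescent →
  SpnTarget` — the `t-U-J` statement on `(0, J₀]` plus the descent at `J = 0` (where the `J`-term
  `(0/4) • Σ …` vanishes) give the closed segment `[0, J₀]`.
* `Assembly` (stmt-HubbardSuperconductivity-1669): `TUJSmallJ → SuperexchangeDescent →
  EvenTorusBookkeeping → HubbardSuperconductivity`, via the target at `J = 0`.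

Sources: F. J. Dyson, E. H. Lieb, B. Simon, J. Stat. Phys. 18 (1978) 335, §1 eq. (4) (normalised
double sums on boxes of even side); D. J. Scalapino, Phys. Rep. 250 (1995) 329, §2. No new
definitions.
-/

-- the mandated namespace `Summit.<Summit>.<Problem>.Theorems` repeats `HubbardSuperconductivity`
-- (single-problem summit, D-0017), which the `dupNamespace` linter flags on every declaration
set_option linter.dupNamespace false

namespace Summit.HubbardSuperconductivity.HubbardSuperconductivity.Theorems.SpNLargeN

open Matrix Filter Literature.MathematicalPhysics.QuantumLattice Literature.Probability.LatticeModels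
open Summit.HubbardSuperconductivity.HubbardSuperconductivity.Theses.SpNLargeN
open Summit.HubbardSuperconductivity.TwTipContinuation.Negative (lroTerm_eq)

/-- **`EvenTorusBookkeeping`** (stmt-HubbardSuperconductivity-1668): for any family `ψ_L`,
`0 < liminf_k Re⟨ψ_{2(k+1)}, Δ_d†Δ_d ψ_{2(k+1)}⟩ / (2(k+1))⁴` implies the summit's conclusion
`HasLongRangeOrder (k ↦ halfOpenBox 2 (2k)) (k ↦ torusPullback (pairFieldCorr g_d ψ) (2k))`:
the LRO sequence shifted by one is the given sequence (`lroTerm_eq` at the nonzero side `2(k+1)`),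
and `liminf` along `atTop` is shift-invariant (`Filter.liminf_nat_add`). Dyson–Lieb–Simon,
J. Stat. Phys. 18 (1978) 335, §1 eq. (4). [folklore] -/
theorem evenTorusBookkeeping_proof :
    Summit.HubbardSuperconductivity.HubbardSuperconductivity.Theses.SpNLargeN.EvenTorusBookkeeping := by
  unfold EvenTorusBookkeeping
  intro ψ hpos
  change 0 < liminf (fun k : ℕ => (∑ x ∈ halfOpenBox 2 (2 * k), ∑ y ∈ halfOpenBox 2 (2 * k),
          torusPullback (pairFieldCorr dWaveFormFactor ψ) (2 * k) x y) /
        ((halfOpenBox 2 (2 * k)).card : ℝ) ^ 2) atTop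
  have hshift : liminf (fun k : ℕ => (∑ x ∈ halfOpenBox 2 (2 * k), ∑ y ∈ halfOpenBox 2 (2 * k),
          torusPullback (pairFieldCorr dWaveFormFactor ψ) (2 * k) x y) /
        ((halfOpenBox 2 (2 * k)).card : ℝ) ^ 2) atTop =
      liminf (fun k : ℕ => (expect ((pairField dWaveFormFactor (2 * (k + 1)))ᴴ *
          pairField dWaveFormFactor (2 * (k + 1))) (ψ (2 * (k + 1)))).re /
        (((2 * (k + 1) : ℕ) : ℝ) ^ 4)) atTop := by
    refine (Filter.liminf_nat_add _ 1).symm.trans (Filter.liminf_congr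
      (Filter.Eventually.of_forall fun k => ?_))
    haveI : NeZero (2 * (k + 1)) := ⟨by omega⟩
    exact lroTerm_eq ψ (k + 1)
  rw [hshift]
  exact hpos

/-- **`SpnTargetOfCruxes`** (stmt-HubbardSuperconductivity-14259): `TUJSmallJ → SuperexchangeDescent
→ SpnTarget`. Take `(U, δ, J₀)` from `TUJSmallJ`; at `J ∈ (0, J₀]` the target's clause is the
`t-U-J` clause verbatim, and at `J = 0` the deformation `(0/4) • Σ_{⟨xy⟩} b†_{xy} b_{xy}`
vanishes, so the clause is the conclusion of `SuperexchangeDescent` at `(U, δ)` fed with the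
`t-U-J` statement. Scalapino, Phys. Rep. 250 (1995) 329, §2. [folklore] -/
theorem spnTargetOfCruxes_proof :
    Summit.HubbardSuperconductivity.HubbardSuperconductivity.Theses.SpNLargeN.SpnTargetOfCruxes := by
  unfold SpnTargetOfCruxes TUJSmallJ SuperexchangeDescent SpnTarget
  rintro ⟨U, δ, J₀, hU, hδ, hJ₀, hJ⟩ hD
  refine ⟨U, δ, J₀, hU, hδ, hJ₀, fun J hJmem N ψ hadm => ?_⟩
  rcases eq_or_lt_of_le hJmem.1 with h0 | hpos
  · subst h0
    simp only [zero_div, Complex.ofReal_zero, zero_smul, sub_zero] at hadm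
    exact hD U δ hU hδ ⟨J₀, hJ₀, hJ⟩ N ψ hadm
  · exact hJ J ⟨hpos, hJmem.2⟩ N ψ hadm

/-- **Assembly of route `SpNLargeN`** (stmt-HubbardSuperconductivity-1669):
`TUJSmallJ → SuperexchangeDescent → EvenTorusBookkeeping → HubbardSuperconductivity`. The target
`SpnTarget` (from `spnTargetOfCruxes_proof`) at `J = 0` is the pure model's shifted-`liminf`
statement at `(U, δ)`, and `EvenTorusBookkeeping` turns it into the summit's matrix.
Scalapino, Phys. Rep. 250 (1995) 329, §2 eq. (2.4). [folklore] -/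
theorem spNLargeN_assembly_proof :
    Summit.HubbardSuperconductivity.HubbardSuperconductivity.Theses.SpNLargeN.Assembly := by
  unfold Assembly
  intro hT hD hB
  obtain ⟨U, δ, J₀, hU, hδ, hJ₀, hJ⟩ := spnTargetOfCruxes_proof hT hD
  have h0 := hJ 0 ⟨le_rfl, hJ₀.le⟩
  simp only [zero_div, Complex.ofReal_zero, zero_smul, sub_zero] at h0
  unfold _root_.HubbardSuperconductivity Literature.Hubbard.DWaveSuperconductivityHubbard
  exact ⟨U, hU, δ, hδ, fun N ψ hadm => hB ψ (h0 N ψ hadm)⟩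

end Summit.HubbardSuperconductivity.HubbardSuperconductivity.Theorems.SpNLargeN
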